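import Mathlib.MeasureTheory.Integral.IntervalIntegral.Basic
import Mathlib.MeasureTheory.Measure.WithDensity
import Mathlib.MeasureTheory.Constructions.Pi
import Mathlib.MeasureTheory.Measure.Prod
import Literature.MathematicalPhysics.KineticTheory.FouriersLaw
import HarnessLib

/-!
# The O(n) vector oscillator chain (vector extension of the pinned anharmonic chain)

Trunk `Literature/MathematicalPhysics/KineticTheory`; definition request
`defn-VectorOscillatorChain` (route `AtomisticToContinuum/FouriersLaw/Theses/PhononLenardBalescu`,
card `large-n-phonon-lenard-balescu`).

## The model

Bonetto–Lebowitz–Rey-Bellet (2000), §3 eq. (8): a crystal `Λ` of unit-mass atoms with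
displacements `q_i ∈ ℝ^ν` ("one can still consider that `p_i` and `q_i ∈ ℝ^ν`, `ν ≠ d`"),
`H(P, Q) = ∑_i p_i²/2 + ∑_{|i-j|=1} V(q_i - q_j) + ∑_i U_i(q_i)`. Here `Λ = {0, …, M-1}` is the
open chain (`d = 1`), the displacements have `n` components, and the potentials are the
`O(n)`-invariant quartic ones with the large-`n` ('t Hooft / Coleman–Jackiw–Politzer 1974)
normalisation of the quartic couplings:
`U(q) = ω₂|q|²/2 + (lam/(4n))|q|⁴`, `V(r) = |r|²/2 + (β/(4n))|r|⁴`, i.e.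
`H_n(q, p) = ∑_x [|p_x|²/2 + ω₂|q_x|²/2 + (lam/(4n))|q_x|⁴] + ∑_{y = x+1} [|q_y - q_x|²/2 + (β/(4n))|q_y - q_x|⁴]`.
Its `n = 1` member is VERBATIM the tree's `pinnedChain ω₂ lam β γ`
(`hamiltonian_one`, `bondCurrent_one`, `totalCurrent_one` below).
The energy current through the bond `(x, x+1)` is BLR §5.2 eq. (23),
`Ψ = f(q_x - q_{x+1}) · (p_x + p_{x+1})/2`, `f = -∇V`, written in the sign convention of the
tree's `OscillatorChain.bondCurrent` (Lepri–Livi–Politi eq. (24)):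
`j_x = -½ (p_x + p_{x+1}) · ∇V(q_{x+1} - q_x) = -½ (1 + (β/n)|r_x|²) (p_x + p_{x+1}) · r_x`,
`r_x = q_{x+1} - q_x`, and `J = ∑_x j_x` is the total current.
The isolated chain evolves under Hamilton's equations `q̇_x = p_x`, `ṗ_x = F_x = -∇_{q_x} H_n`
(`force`, `IsFlow`); its Gibbs state at temperature `T` is `Z⁻¹ e^{-H_n/T} dq dp` (BLR §3), and
the Green–Kubo conductivity (BLR §7 eq. (37),
`κ_GK = lim_L (L/A) T⁻² ∫_0^∞ ⟨Φ Ŝ_0^t Φ⟩ dt`) is recorded in its finite-time (Einstein–Helfand)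
form per site and per component,
`𝒦_{n,M}(t) = E_Gibbs[(∫_0^t J(Φ_s z) ds)²] / (2 t M n T²) ∈ [0, ∞]`
(`finiteTimeConductivity`; template `RotorChain.finiteTimeConductivity` of the barrier catalogue).
The chain between Langevin heat baths (BLR §4.1 eq. (10): Ornstein–Uhlenbeck forces
`-γ p_i + (2γT_α)^{1/2} ξ_α` on the boundary atoms, acting on every component) has the generator
`L f = ∑_{x,a} (p_x^a ∂_{q_x^a} f - ∂_{q_x^a} H_n ∂_{p_x^a} f) + γ ∑_{x = 0, a} (T_L ∂²_{p_x^a} f - p_x^a ∂_{p_x^a} f) + γ ∑_{x = M-1, a} (T_R ∂²_{p_x^a} f - p_x^a ∂_{p_x^a} f)`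
(`generator`), steady states `IsSteadyState`, mean current `meanTotalCurrent` and the
Fourier-law predicate `FouriersLawFor` — the `OscillatorChain` interface of
`Literature/MathematicalPhysics/KineticTheory/FouriersLaw.lean`, one component index deeper.

## Contents

* `VectorPhaseSpace n M = (Fin M → Fin n → ℝ) × (Fin M → Fin n → ℝ)`; coordinate partial
  derivatives `VectorPhaseSpace.partialQ / partialP`.
* `VectorOscillatorChain` — the data `(ω₂, lam, β, γ)`; in its namespace: `hamiltonian`,
  `bondCurrent`, `totalCurrent`, `force`, `IsFlow`, `partitionFunction`, `gibbsMeasure`,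
  `finiteTimeConductivity`, `generator`, `IsSteadyState`, `meanTotalCurrent`, `FouriersLawFor`.
* API: `hamiltonian_one`, `bondCurrent_one`, `totalCurrent_one` (the `n = 1` member is
  `pinnedChain ω₂ lam β γ`), `deriv_pinnedChain_V`, `bondCurrent_eq_zero_of_le`,
  `hamiltonian_nonneg`, `isProbabilityMeasure_gibbsMeasure`, `generator_const`,
  `meanTotalCurrent_eq_integral_totalCurrent`.

## Design choices

* The bodies of `hamiltonian`, `totalCurrent` (after unfolding `bondCurrent`), `force`, `IsFlow`,
  `gibbsMeasure` (after unfolding `partitionFunction`) and `finiteTimeConductivity` are, for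
  `P = ⟨ω₂, lam, β, γ⟩`, SYNTACTICALLY the `let H, J, F, IsFlow, μ, 𝒦` preambles of the items of
  route `PhononLenardBalescu` (`dsimp only` restates those items over the named definitions).
* The structure carries the four couplings of this specific `O(n)` family rather than general
  radial potentials: the `1/n` normalisation is part of the notion, the force and the current
  are then explicit polynomials (no `deriv` junk values), and no requester needs more.
* `IsFlow` quantifies Hamilton's equations for a candidate flow map `Φ : ℝ → phase space → phase
  space` (jointly continuous, `Φ_0 = id`), as `RotorChain.IsFlow` does; statements are then made
  "for every flow", which is harmless once global existence and uniqueness is known (coercive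
  polynomial energy) and vacuous for no parameter values of interest.
* `gibbsMeasure` is `Z⁻¹ • (e^{-H_n/T} · Lebesgue)` with `Z = partitionFunction ∈ [0, ∞]`; it is
  a probability measure iff `0 < Z < ∞` (`isProbabilityMeasure_gibbsMeasure`), which holds for
  `ω₂ > 0`, `lam, β ≥ 0`, `T > 0`, `n ≥ 1` (not proved here).
* `finiteTimeConductivity` lives in `ℝ≥0∞` (`ofReal` of a square, integrated): no integrability
  is presupposed; for `t ≤ 0` or `M n = 0` the prefactor is the junk value `ofReal (1/0) = 0` or
  `ofReal` of a negative number `= 0`.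
* `generator` mirrors `OscillatorChain.generator`: drift `∂_{q} H_n` through
  `VectorPhaseSpace.partialQ` (one-variable `deriv` along the coordinate line), baths on the
  sites with `x.val = 0` and `x.val = M - 1`, every component thermostatted at the same `γ, T_α`.
* `FouriersLawFor P n` is BLR's (33) for the `n`-component chain at fixed `n`, `M → ∞`, with the
  current per component (`meanTotalCurrent / n`, the normalisation of `finiteTimeConductivity`);
  for `n = 0` (no degrees of freedom) it is false for trivial reasons (`κ > 0` fails).
* Not here: the closed-form identity `∂_{q_x^a} H_n = -F_x^a` and the `n = 1` identification of
  the generator / steady states with `pinnedChain` (separate proof files); global existence of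
  the flow; normalisability of the Gibbs weight; any statement of the route.
-/

noncomputable section

open MeasureTheory Filter Topology Set
open scoped ContDiff ENNReal

namespace Literature.MathematicalPhysics.KineticTheory.HeatConduction

/-! ### Phase space and coordinate derivatives -/

/-- Phase space of the open chain of `M` sites whose displacements and momenta have `n`
components: `z = (q, p)` with `q x a = q_x^a`, `p x a = p_x^a` (`x : Fin M`, `a : Fin n`).
[Bonetto–Lebowitz–Rey-Bellet 2000, §3: "`p_i` and `q_i ∈ ℝ^ν`"] [cite: BonettoLebowitzReyBellet2000, §3 eq. (8)] -/
abbrev VectorPhaseSpace (n M : ℕ) : Type := (Fin M → Fin n → ℝ) × (Fin M → Fin n → ℝ)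

namespace VectorPhaseSpace

variable {n M : ℕ}

/-- Partial derivative along the position coordinate `q_x^a`:
`∂_{q_x^a} f (q, p) = d/dt f(q[x ↦ q_x[a ↦ t]], p) |_{t = q_x^a}` (junk `0` where the
one-variable derivative does not exist). [folklore] -/
def partialQ (x : Fin M) (a : Fin n) (f : VectorPhaseSpace n M → ℝ) (z : VectorPhaseSpace n M) :
    ℝ :=
  deriv (fun t => f (Function.update z.1 x (Function.update (z.1 x) a t), z.2)) (z.1 x a)

/-- Partial derivative along the momentum coordinate `p_x^a`:
`∂_{p_x^a} f (q, p) = d/dt f(q, p[x ↦ p_x[a ↦ t]]) |_{t = p_x^a}`. [folklore] -/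
def partialP (x : Fin M) (a : Fin n) (f : VectorPhaseSpace n M → ℝ) (z : VectorPhaseSpace n M) :
    ℝ :=
  deriv (fun t => f (z.1, Function.update z.2 x (Function.update (z.2 x) a t))) (z.2 x a)

end VectorPhaseSpace

/-! ### The chain -/

/-- The `O(n)` vector oscillator chain (the vector extension of `pinnedChain ω₂ lam β γ`): the
data are the harmonic pinning `ω₂`, the quartic pinning `lam`, the quartic (FPU-β) coupling `β`
— both quartic couplings carry the large-`n` normalisation `1/n` in the Hamiltonian
`H_n = ∑_x [|p_x|²/2 + ω₂|q_x|²/2 + (lam/(4n))|q_x|⁴] + ∑_{y=x+1} [|q_y-q_x|²/2 + (β/(4n))|q_y-q_x|⁴]`,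
`q_x, p_x ∈ ℝⁿ` — and the Langevin bath coupling `γ` (not entering `H_n`).
[Bonetto–Lebowitz–Rey-Bellet 2000, §3 eq. (8) (`U(q) = ω₂|q|²/2 + (lam/4n)|q|⁴`,
`V(r) = |r|²/2 + (β/4n)|r|⁴`, `m = 1`); Coleman–Jackiw–Politzer 1974 (quartic coupling `∝ 1/N`
in the `O(N)` model)] [cite: BonettoLebowitzReyBellet2000, §3 eq. (8)] -/
structure VectorOscillatorChain where
  /-- the harmonic pinning frequency squared `ω₂` (`U(q) = ω₂|q|²/2 + …`) -/
  ω₂ : ℝ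
  /-- the quartic pinning constant `lam` (`… + (lam/(4n))|q|⁴`) -/
  lam : ℝ
  /-- the quartic coupling constant `β` (`V(r) = |r|²/2 + (β/(4n))|r|⁴`) -/
  β : ℝ
  /-- the coupling constant `γ` of the Langevin baths (friction `γ`, noise `√(2γT)`) -/
  γ : ℝ

namespace VectorOscillatorChain

variable (P : VectorOscillatorChain)

/-- The Hamiltonian
`H_n(q, p) = ∑_x [|p_x|²/2 + ω₂|q_x|²/2 + (lam/(4n)) (|q_x|²)²] + ∑_x ∑_{y = x+1} [|q_y - q_x|²/2 + (β/(4n)) (|q_y - q_x|²)²]`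
of the open `M`-site chain with `n` components (`|v|² = ∑_a v_a²`; free ends, unit masses).
[Bonetto–Lebowitz–Rey-Bellet 2000, §3 eq. (8) with these `U`, `V`] [cite: BonettoLebowitzReyBellet2000, §3 eq. (8)] -/
def hamiltonian (n M : ℕ) (z : VectorPhaseSpace n M) : ℝ :=
  (∑ x : Fin M, ((∑ a, (z.2 x a) ^ 2) / 2 + P.ω₂ * (∑ a, (z.1 x a) ^ 2) / 2 +
      P.lam / (4 * (n : ℝ)) * (∑ a, (z.1 x a) ^ 2) ^ 2)) +
    ∑ x : Fin M, ∑ y : Fin M, (if y.val = x.val + 1 then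
      ((∑ a, (z.1 y a - z.1 x a) ^ 2) / 2 +
        P.β / (4 * (n : ℝ)) * (∑ a, (z.1 y a - z.1 x a) ^ 2) ^ 2) else 0)

/-- The energy current through the bond `(x, x+1)`:
`j_x = -½ (1 + (β/n)|q_{x+1} - q_x|²) ∑_a (p_x^a + p_{x+1}^a)(q_{x+1}^a - q_x^a)`, i.e.
`-½ (p_x + p_{x+1}) · ∇V(q_{x+1} - q_x)` for `V(r) = |r|²/2 + (β/(4n))|r|⁴` (and `0` at the
last site). [Bonetto–Lebowitz–Rey-Bellet 2000, §5.2 eq. (23) (`Ψ = f(q_i - q_{i+1})·(p_i + p_{i+1})/2`,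
`f = -∇V`), in the sign convention of `OscillatorChain.bondCurrent` / Lepri–Livi–Politi (24)]
[cite: BonettoLebowitzReyBellet2000, §5.2 eq. (23)] -/
def bondCurrent (n M : ℕ) (x : Fin M) (z : VectorPhaseSpace n M) : ℝ :=
  ∑ y : Fin M, (if y.val = x.val + 1 then
    -((1 + P.β / (n : ℝ) * ∑ a, (z.1 y a - z.1 x a) ^ 2) *
        (∑ a, (z.2 x a + z.2 y a) * (z.1 y a - z.1 x a))) / 2 else 0)

/-- The total energy current `J = ∑_x j_x` (a function on phase space).
[Bonetto–Lebowitz–Rey-Bellet 2000, §5.2 eq. (23)–(24), §7] [cite: BonettoLebowitzReyBellet2000, §5.2 eq. (24)] -/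
def totalCurrent (n M : ℕ) (z : VectorPhaseSpace n M) : ℝ :=
  ∑ x : Fin M, P.bondCurrent n M x z

/-- The force on component `a` of site `x`, `F_x^a = -∂H_n/∂q_x^a`, in closed form:
`-(ω₂ + (lam/n)|q_x|²) q_x^a + ∑_{y = x+1} (1 + (β/n)|q_y - q_x|²)(q_y^a - q_x^a) - ∑_{x = y+1} (1 + (β/n)|q_x - q_y|²)(q_x^a - q_y^a)`.
[folklore] -/
def force (n M : ℕ) (z : VectorPhaseSpace n M) (x : Fin M) (a : Fin n) : ℝ :=
  -(P.ω₂ + P.lam / (n : ℝ) * ∑ b, (z.1 x b) ^ 2) * z.1 x a +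
      (∑ y : Fin M, (if y.val = x.val + 1 then
        (1 + P.β / (n : ℝ) * ∑ b, (z.1 y b - z.1 x b) ^ 2) * (z.1 y a - z.1 x a) else 0)) -
    ∑ y : Fin M, (if x.val = y.val + 1 then
      (1 + P.β / (n : ℝ) * ∑ b, (z.1 x b - z.1 y b) ^ 2) * (z.1 x a - z.1 y a) else 0)

/-- `P.IsFlow n M Φ`: `Φ : ℝ → phase space → phase space` is a flow map of Hamilton's equations
of the isolated chain — jointly continuous in `(t, z)`, `Φ_0 = id`, and for every initial
condition `z`, site `x` and time `t`: `d/dt q_x(t) = p_x(t)` and `d/dt p_x(t) = F_x(q(t))`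
(vector-valued derivatives in `ℝⁿ`). [folklore] -/
def IsFlow (n M : ℕ) (Φ : ℝ → VectorPhaseSpace n M → VectorPhaseSpace n M) : Prop :=
  Continuous (fun p : ℝ × VectorPhaseSpace n M => Φ p.1 p.2) ∧ (∀ z, Φ 0 z = z) ∧
    ∀ z (x : Fin M) (t : ℝ), HasDerivAt (fun s => (Φ s z).1 x) ((Φ t z).2 x) t ∧
      HasDerivAt (fun s => (Φ s z).2 x) (P.force n M (Φ t z) x) t

/-- The partition function `Z = ∫ e^{-H_n(z)/T} dz ∈ [0, ∞]` (Lebesgue measure on phase space).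
[Bonetto–Lebowitz–Rey-Bellet 2000, §3] [cite: BonettoLebowitzReyBellet2000, §3] -/
def partitionFunction (n M : ℕ) (T : ℝ) : ℝ≥0∞ :=
  ∫⁻ z, ENNReal.ofReal (Real.exp (-(P.hamiltonian n M z) / T))

/-- The Gibbs state at temperature `T`: `Z⁻¹ e^{-H_n/T} dq dp` ("the addition of `U_i(q)` pins
down the crystal and ensures that `exp[-βH(P,Q)]` is integrable … and thus the corresponding
Gibbs measure is well defined"). [Bonetto–Lebowitz–Rey-Bellet 2000, §3] [cite: BonettoLebowitzReyBellet2000, §3] -/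
def gibbsMeasure (n M : ℕ) (T : ℝ) : Measure (VectorPhaseSpace n M) :=
  (P.partitionFunction n M T)⁻¹ •
    volume.withDensity (fun z => ENNReal.ofReal (Real.exp (-(P.hamiltonian n M z) / T)))

/-- The finite-time (Einstein–Helfand) Green–Kubo conductivity per site and per component,
`𝒦_{n,M}(t) = E_{Gibbs(T)}[(∫_0^t J(Φ_s z) ds)²] / (2 t M n T²) ∈ [0, ∞]`, for a flow map `Φ` of
the isolated chain; since `E[(∫_0^t J)²] = 2 ∫_0^t (t - s) E[J J(s)] ds`, its `t → ∞` limit is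
the Green–Kubo integral `(M n T²)⁻¹ ∫_0^∞ E[J J(s)] ds` of BLR eq. (37) (there with `L/A` for a
current through one plane; here `J` is summed over the `M` bonds and the `n` components, whence
the division by `M n`) whenever the current autocorrelation is integrable.
[Bonetto–Lebowitz–Rey-Bellet 2000, §7 eq. (37); finite-time form as in De Roeck–Huveneers 2015,
eq. (2.6)] [cite: BonettoLebowitzReyBellet2000, §7 eq. (37)] -/
def finiteTimeConductivity (n M : ℕ) (T : ℝ) (Φ : ℝ → VectorPhaseSpace n M → VectorPhaseSpace n M)
    (t : ℝ) : ℝ≥0∞ :=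
  ENNReal.ofReal (1 / (2 * t * (M : ℝ) * (n : ℝ) * T ^ 2)) *
    ∫⁻ z, ENNReal.ofReal ((∫ s in (0 : ℝ)..t, P.totalCurrent n M (Φ s z)) ^ 2)
      ∂(P.gibbsMeasure n M T)

/-! ### The chain between Langevin heat baths -/

/-- The generator of the `n`-component chain coupled to Langevin baths at temperature `T_L` on
site `0` and `T_R` on site `M - 1`, every component of the boundary momenta receiving friction
`-γ p_x^a` and noise `√(2γT_α) dW_x^a`:
`L f = ∑_{x,a} (p_x^a ∂_{q_x^a} f - ∂_{q_x^a} H_n ∂_{p_x^a} f) + γ ∑_{x = 0} ∑_a (T_L ∂²_{p_x^a} f - p_x^a ∂_{p_x^a} f) + γ ∑_{x = M-1} ∑_a (T_R ∂²_{p_x^a} f - p_x^a ∂_{p_x^a} f)`.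
[Bonetto–Lebowitz–Rey-Bellet 2000, §4.1 eq. (10) (`λ_α = γ`, `m_i = 1`, vector noise `ξ_α`)]
[cite: BonettoLebowitzReyBellet2000, §4.1 eq. (10)] -/
def generator (n M : ℕ) (T_L T_R : ℝ) (f : VectorPhaseSpace n M → ℝ) (z : VectorPhaseSpace n M) :
    ℝ :=
  (∑ x : Fin M, ∑ a : Fin n,
      (z.2 x a * VectorPhaseSpace.partialQ x a f z -
        VectorPhaseSpace.partialQ x a (P.hamiltonian n M) z * VectorPhaseSpace.partialP x a f z)) +
    P.γ * ∑ x : Fin M, ∑ a : Fin n,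
      ((if x.val = 0 then
          T_L * VectorPhaseSpace.partialP x a (VectorPhaseSpace.partialP x a f) z -
            z.2 x a * VectorPhaseSpace.partialP x a f z else 0) +
        (if x.val = M - 1 then
          T_R * VectorPhaseSpace.partialP x a (VectorPhaseSpace.partialP x a f) z -
            z.2 x a * VectorPhaseSpace.partialP x a f z else 0))

/-- `P.IsSteadyState n M T_L T_R μ`: `μ` is a stationary state of the `M`-site, `n`-component
chain between baths at `T_L, T_R` — a probability measure solving the stationary Kolmogorov
equation weakly (`∫ L f dμ = 0` for all smooth compactly supported `f`) under which the bond
currents are integrable. [Bonetto–Lebowitz–Rey-Bellet 2000, §5.1] [cite: BonettoLebowitzReyBellet2000, §5.1] -/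
def IsSteadyState (n M : ℕ) (T_L T_R : ℝ) (μ : Measure (VectorPhaseSpace n M)) : Prop :=
  IsProbabilityMeasure μ ∧
    (∀ f : VectorPhaseSpace n M → ℝ, ContDiff ℝ ∞ f → HasCompactSupport f →
      ∫ z, P.generator n M T_L T_R f z ∂μ = 0) ∧
    ∀ x : Fin M, Integrable (P.bondCurrent n M x) μ

/-- The space-summed mean energy current `∑_x ∫ j_x dμ` in the state `μ` (in a steady state all
bond currents have the same mean `J̃`, so this is `(M - 1) J̃`); the analogue of
`OscillatorChain.totalCurrent`. [Bonetto–Lebowitz–Rey-Bellet 2000, §1 and §5.2 eq. (24)]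
[cite: BonettoLebowitzReyBellet2000, §1] -/
def meanTotalCurrent {n M : ℕ} (μ : Measure (VectorPhaseSpace n M)) : ℝ :=
  ∑ x : Fin M, ∫ z, P.bondCurrent n M x z ∂μ

/-- **Fourier's law for the `n`-component chain `P`** (BLR eq. (33), at fixed `n`, chain length
`M → ∞`, current per component): (i) for all `M` and `T_L, T_R > 0` the steady state exists and
is unique, and (ii) there is `κ : ℝ → ℝ`, `κ(T) > 0` for `T > 0`, such that for every family of
steady states `μ M T_L T_R` and every `T > 0` the linear-response limits
`D_M = lim_{δ → 0, δ ≠ 0} (n⁻¹ ∑_x μ_{M, T+δ/2, T-δ/2}(j_x)) / δ` exist and `D_M → κ(T)` as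
`M → ∞`. The analogue of `OscillatorChain.FouriersLawFor` (which is the case `n = 1` up to the
identification of phase spaces); a PREDICATE on `(P, n)`, open for `n ≥ 1` and all
`ω₂, lam, β, γ > 0`, trivially false for `n = 0`.
[Bonetto–Lebowitz–Rey-Bellet 2000, §5.3 eq. (33)] [cite: BonettoLebowitzReyBellet2000, §5.3 eq. (33)] -/
def FouriersLawFor (n : ℕ) : Prop :=
  (∀ (M : ℕ) (T_L T_R : ℝ), 0 < T_L → 0 < T_R →
      ∃ μ : Measure (VectorPhaseSpace n M), P.IsSteadyState n M T_L T_R μ ∧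
        ∀ ν : Measure (VectorPhaseSpace n M), P.IsSteadyState n M T_L T_R ν → ν = μ) ∧
  ∃ κ : ℝ → ℝ, (∀ T, 0 < T → 0 < κ T) ∧
    ∀ μ : (M : ℕ) → ℝ → ℝ → Measure (VectorPhaseSpace n M),
      (∀ (M : ℕ) (T_L T_R : ℝ), 0 < T_L → 0 < T_R →
        P.IsSteadyState n M T_L T_R (μ M T_L T_R)) →
      ∀ T : ℝ, 0 < T →
        ∃ D : ℕ → ℝ,
          (∀ M : ℕ, Tendsto
            (fun δ : ℝ => P.meanTotalCurrent (μ M (T + δ / 2) (T - δ / 2)) / (n : ℝ) / δ)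
            (𝓝[≠] 0) (𝓝 (D M))) ∧
          Tendsto D atTop (𝓝 (κ T))

/-! ### API -/

/-- `J = ∑_x j_x`. [folklore] -/
theorem totalCurrent_eq_sum_bondCurrent (n M : ℕ) (z : VectorPhaseSpace n M) :
    P.totalCurrent n M z = ∑ x : Fin M, P.bondCurrent n M x z := rfl

/-- The last site carries no bond current (free boundary). [folklore] -/
theorem bondCurrent_eq_zero_of_le {n M : ℕ} (x : Fin M) (hx : M ≤ x.val + 1)
    (z : VectorPhaseSpace n M) : P.bondCurrent n M x z = 0 := by
  unfold bondCurrent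
  refine Finset.sum_eq_zero fun y _ => ?_
  have hy : y.val ≠ x.val + 1 := by have := y.isLt; omega
  simp [hy]

/-- The Hamiltonian is non-negative for `ω₂, lam, β ≥ 0`. [folklore] -/
theorem hamiltonian_nonneg (hω : 0 ≤ P.ω₂) (hlam : 0 ≤ P.lam) (hβ : 0 ≤ P.β) (n M : ℕ)
    (z : VectorPhaseSpace n M) : 0 ≤ P.hamiltonian n M z := by
  unfold hamiltonian
  refine add_nonneg (Finset.sum_nonneg fun x _ => ?_)
    (Finset.sum_nonneg fun x _ => Finset.sum_nonneg fun y _ => ?_)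
  · have hS : 0 ≤ ∑ a, (z.1 x a) ^ 2 := Finset.sum_nonneg fun a _ => sq_nonneg _
    have hK : 0 ≤ ∑ a, (z.2 x a) ^ 2 := Finset.sum_nonneg fun a _ => sq_nonneg _
    positivity
  · split_ifs
    · have hR : 0 ≤ ∑ a, (z.1 y a - z.1 x a) ^ 2 := Finset.sum_nonneg fun a _ => sq_nonneg _
      positivity
    · exact le_rfl

/-- If `0 < Z < ∞` the Gibbs state is a probability measure. [folklore] -/
theorem isProbabilityMeasure_gibbsMeasure {n M : ℕ} {T : ℝ}
    (h0 : P.partitionFunction n M T ≠ 0) (htop : P.partitionFunction n M T ≠ ⊤) :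
    IsProbabilityMeasure (P.gibbsMeasure n M T) := by
  refine ⟨?_⟩
  rw [gibbsMeasure, Measure.smul_apply, withDensity_apply _ MeasurableSet.univ,
    Measure.restrict_univ, smul_eq_mul]
  exact ENNReal.inv_mul_cancel h0 htop

/-- The generator annihilates constants (`L 1 = 0`). [folklore] -/
@[simp] theorem generator_const (n M : ℕ) (T_L T_R c : ℝ) (z : VectorPhaseSpace n M) :
    P.generator n M T_L T_R (fun _ => c) z = 0 := by
  simp [generator, VectorPhaseSpace.partialQ, VectorPhaseSpace.partialP]

/-- With integrable bond currents the mean total current is the mean of `J`. [folklore] -/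
theorem meanTotalCurrent_eq_integral_totalCurrent {n M : ℕ} (μ : Measure (VectorPhaseSpace n M))
    (h : ∀ x : Fin M, Integrable (P.bondCurrent n M x) μ) :
    P.meanTotalCurrent μ = ∫ z, P.totalCurrent n M z ∂μ := by
  unfold meanTotalCurrent totalCurrent
  exact (integral_finsetSum _ fun x _ => h x).symm

/-! ### The `n = 1` member is `pinnedChain ω₂ lam β γ` -/

/-- `V'(r) = (1 + β r²) r` for the FPU-β coupling `V(r) = r²/2 + β r⁴/4` of `pinnedChain`.
[folklore] -/
theorem _root_.Literature.MathematicalPhysics.KineticTheory.HeatConduction.deriv_pinnedChain_V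
    (ω₂ lam β γ r : ℝ) : deriv (pinnedChain ω₂ lam β γ).V r = (1 + β * r ^ 2) * r := by
  show deriv (fun r : ℝ => r ^ 2 / 2 + β * r ^ 4 / 4) r = _
  have h2 : HasDerivAt (fun r : ℝ => r ^ 2) (2 * r) r := by simpa using hasDerivAt_pow 2 r
  have h4 : HasDerivAt (fun r : ℝ => r ^ 4) (4 * r ^ 3) r := by simpa using hasDerivAt_pow 4 r
  have h : HasDerivAt (fun r : ℝ => r ^ 2 / 2 + β * r ^ 4 / 4)
      (2 * r / 2 + β * (4 * r ^ 3) / 4) r :=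
    (h2.div_const 2).add ((h4.const_mul β).div_const 4)
  rw [h.deriv]
  ring

/-- At `n = 1` the Hamiltonian is that of `pinnedChain ω₂ lam β γ` (`q_i = z.1 i 0`,
`p_i = z.2 i 0`). [Bonetto–Lebowitz–Rey-Bellet 2000, §3 eq. (8)] [folklore] -/
theorem hamiltonian_one (M : ℕ) (z : VectorPhaseSpace 1 M) :
    P.hamiltonian 1 M z =
      (pinnedChain P.ω₂ P.lam P.β P.γ).hamiltonian M (fun i => z.1 i 0, fun i => z.2 i 0) := by
  simp only [hamiltonian, OscillatorChain.hamiltonian, pinnedChain, Fin.sum_univ_one,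
    Nat.cast_one, mul_one]
  congr 1
  · exact Finset.sum_congr rfl fun x _ => by ring
  · exact Finset.sum_congr rfl fun x _ => Finset.sum_congr rfl fun y _ => by
      split_ifs <;> ring

/-- At `n = 1` the bond currents are those of `pinnedChain ω₂ lam β γ`.
[Bonetto–Lebowitz–Rey-Bellet 2000, §5.2 eq. (23)] [folklore] -/
theorem bondCurrent_one (M : ℕ) (x : Fin M) (z : VectorPhaseSpace 1 M) :
    P.bondCurrent 1 M x z =
      (pinnedChain P.ω₂ P.lam P.β P.γ).bondCurrent M x
        (fun i => z.1 i 0, fun i => z.2 i 0) := by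
  simp only [bondCurrent, OscillatorChain.bondCurrent, deriv_pinnedChain_V, Fin.sum_univ_one,
    Nat.cast_one, div_one]
  exact Finset.sum_congr rfl fun y _ => by split_ifs <;> ring

/-- At `n = 1` the total current is `∑_i j_i` of `pinnedChain ω₂ lam β γ`. [folklore] -/
theorem totalCurrent_one (M : ℕ) (z : VectorPhaseSpace 1 M) :
    P.totalCurrent 1 M z = ∑ i : Fin M,
      (pinnedChain P.ω₂ P.lam P.β P.γ).bondCurrent M i (fun i => z.1 i 0, fun i => z.2 i 0) :=
  Finset.sum_congr rfl fun x _ => P.bondCurrent_one M x z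

end VectorOscillatorChain

end Literature.MathematicalPhysics.KineticTheory.HeatConduction
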